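import Summits.AtomisticToContinuum.HydrodynamicLimit.Theorems.StiffCollisionalRelaxationAprioriBoundsFibreKLGlue
import Summits.AtomisticToContinuum.HydrodynamicLimit.Theorems.StiffCollisionalRelaxationAprioriBoundsFibreKLTransfer
import HarnessLib

/-!
# The rate-free lever `stub_klLever` of the line `fibre-deficit-transfer` (skeleton r4; crux `AprioriBounds`,
stmt-AtomisticToContinuum-14827)

Proof file (`--supports stmt-AtomisticToContinuum-14827`) of the lead prover of the line: the registered stub `stub_klLever`,
`BracketIntegratedVanishAt ∧ LinStatL1VanishAt ⟹ IntegratedBulkTailAt` — rate-free statics + isentropy and hydrodynamics in the mean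
on `[0, t]` give, through the identity of the line (`klIntegratedVanish_of_bracket_linStat`, time-integrated relative entropy `o(N)`
against the local Gibbs laws of the slice activity) and the rate-free entropy transfer (`integratedBulkTail_of_klDiv_integrated`,
Hoeffding at fixed slack + Kipnis–Landim), time-integrated sub-Maxwellian bulk tails with any fixed slack.  No rates anywhere.
-/

noncomputable section

open MeasureTheory Filter Set Topology InformationTheory
open scoped ENNReal

namespace Summit.AtomisticToContinuum.HydrodynamicLimit.Theorems.FibreDeficitTransfer

open Literature.MathematicalPhysics.KineticTheory Literature.Analysis.FluidPDE
open Summit.AtomisticToContinuum.HydrodynamicLimit.Theorems.VisitLedgerUpscattering (Cfg Flow Flows NiceProfiles)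

/-- STUB 5 of skeleton r4 — **THE RATE-FREE LEVER** `stub_klLever` (registered signature): for `0 < σ < 1/2`, nice profiles, `t > 0`,
fields jointly continuous on `[0,t] × 𝕋³` with `θ > 0` and a jointly continuous density multiplier,
`BracketIntegratedVanishAt ∧ LinStatL1VanishAt ⟹ IntegratedBulkTailAt`. -/
theorem stub_klLever : ∀ (σ : ℝ) (a₀ θ₀ : T3 → ℝ) (u₀ : T3 → V3) (ρ θ : ℝ → T3 → ℝ) (u : ℝ → T3 → V3) (Φ : (N : ℕ) → HardSphereFlow (Torus.geometry (Fin 3)) (hsDiameter σ N) (N + 1)) (t : ℝ), 0 < σ → σ < 1 / 2 → NiceProfiles a₀ θ₀ u₀ → 0 < t → ContinuousOn (Function.uncurry ρ) (Icc 0 t ×ˢ univ) → ContinuousOn (Function.uncurry θ) (Icc 0 t ×ˢ univ) → ContinuousOn (Function.uncurry u) (Icc 0 t ×ˢ univ) → (∀ s ∈ Icc 0 t, ∀ x, 0 < θ s x) → ContinuousOn (fun p : ℝ × T3 => lam0 σ (ρ p.1 p.2) (θ p.1 p.2) (u p.1 p.2)) (Icc 0 t ×ˢ univ) → BracketIntegratedVanishAt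 σ a₀ θ₀ u₀ ρ θ u t → LinStatL1VanishAt σ a₀ θ₀ u₀ ρ θ u Φ t → IntegratedBulkTailAt σ a₀ θ₀ u₀ Φ t := by
  intro σ a₀ θ₀ u₀ ρ θ u Φ t hσ hσ2 hP ht hρc hθc huc hθ hΛ hB hL
  have hKL := klIntegratedVanish_of_bracket_linStat σ a₀ θ₀ u₀ ρ θ u Φ t hσ hσ2 hP ht hρc hθc huc hθ hΛ hB hL
  have hbc : ∀ s ∈ Icc 0 t, Continuous (sliceAct σ ρ θ u s) := fun s hs =>
    continuous_sliceAct s (continuous_slice hθc hs) (continuous_slice huc hs) (hθ s hs)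
      (continuous_slice (f := fun s x => lam0 σ (ρ s x) (θ s x) (u s x)) hΛ hs)
  have hbpos : ∀ s ∈ Icc 0 t, ∀ x, 0 < sliceAct σ ρ θ u s x := fun s hs x => sliceAct_pos s x (hθ s hs x)
  exact integratedBulkTail_of_klDiv_integrated σ a₀ θ₀ u₀ (sliceAct σ ρ θ u) θ u Φ t hσ hσ2 hP ht hθc huc hθ hbc hbpos hKL

end Summit.AtomisticToContinuum.HydrodynamicLimit.Theorems.FibreDeficitTransfer

end
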